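import Summits.ABC.ABC.Theses.CongruentialReceptacle

/-!
# Sketch (crux-ideate r1 k1) — TameLocalReceptacle (stmt-ABC-14354): single-table transfer and
# residue pinning by ternary smooth families

Idea card `ternary-smooth-pinning`.  This file types the objects of the card:

* `IntegerTameReceptacle` — the TRANSFER C⁺: one integer table, exact bounded sum, no modulus,
  no `ℓ ∤ abc`; `tlr_of_itr` and `itr_of_tlr` (compactness) are BOTH PROVED: C⁺ is EQUIVALENT to the crux.
* `pinning_means` (proved) — the averaging form of pinning.
* `PinningFamilies κ A` — the ternary-smooth equidistribution hypothesis EH in the exact form it is used.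
* `nearResidueFree_of_pinning` (PROVED) — EH ⇒ every ITR table is residue-free up to `2c₃ + c₁'A`.
* `false_of_nearResidueFree` (the ONE remaining stub, size L) — the four-family slope contradiction
  (refuter ATTACK §4.1 with O(K·ω) slack; Chebyshev + Mertens, both in tree).
* `not_tameLocalReceptacle_of_pinning` — the composition: EH ⇒ ¬ TameLocalReceptacle (modulo that one stub).

Nothing here is a route item; it is the first-lemma sketch the protocol asks to elaborate.
-/

namespace Summit.ABC.ABC.Cruxes.TameLocalReceptacle.TernarySmoothPinning

open Finset Filter Topology Literature.NumberTheory.DiophantineGeometry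
open Summit.ABC.ABC.Theses.CongruentialReceptacle

/-- A tame-local integer table `t(p; i,j,k; r,s,z)`. -/
abbrev Table : Type := ℕ → ℕ → ℕ → ℕ → ℕ → ℕ → ℕ → ℤ

/-- A real-valued weight on tame data (test functions for intensity comparison). -/
abbrev RTable : Type := ℕ → ℕ → ℕ → ℕ → ℕ → ℕ → ℕ → ℝ

/-- The crux's window for constants `(ε, c₁, c₁')`. -/
def InWindow (ε c₁ c₁' : ℝ) (t : Table) : Prop :=
  ∀ p i j k r s z : ℕ, p.Prime →
    c₁ * (2 * ((i + j + k : ℕ) : ℝ) - 6 - ε) * Real.log p ≤ (t p i j k r s z : ℝ) ∧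
      |(t p i j k r s z : ℝ)| ≤ c₁' * (((i + j + k : ℕ) : ℝ) + 1) * Real.log p

/-- The tame datum `D_p(a,b,c) = (v_p a, v_p b, v_p c; a' mod p, b' mod p, c' mod p)`. -/
def datum (a b c p : ℕ) : ℕ × ℕ × ℕ × ℕ × ℕ × ℕ :=
  (a.factorization p, b.factorization p, c.factorization p,
    a / p ^ a.factorization p % p, b / p ^ b.factorization p % p, c / p ^ c.factorization p % p)

/-- Evaluate a (curried) table at a datum. -/
def evalAt {β : Type} (t : ℕ → ℕ → ℕ → ℕ → ℕ → ℕ → ℕ → β) (p : ℕ) (D : ℕ × ℕ × ℕ × ℕ × ℕ × ℕ) : β :=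
  t p D.1 D.2.1 D.2.2.1 D.2.2.2.1 D.2.2.2.2.1 D.2.2.2.2.2

/-- The receptacle sum `Φ_t(a,b,c) = Σ_{p ∣ abc} t(p; D_p)` — literally the sum in the crux. -/
def recSum (t : Table) (a b c : ℕ) : ℤ :=
  ∑ p ∈ (a * b * c).primeFactors, t p (a.factorization p) (b.factorization p) (c.factorization p)
    (a / p ^ a.factorization p % p) (b / p ^ b.factorization p % p) (c / p ^ c.factorization p % p)

/-- The same sum for a real weight, omitting one prime `p` (the "other data" of a triple). -/
noncomputable def recSumAway (w : RTable) (p a b c : ℕ) : ℝ :=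
  ∑ q ∈ ((a * b * c).primeFactors).erase p, evalAt w q (datum a b c q)

/-- `κ`-balanced abc triple (the cell of the crux). -/
def IsBalanced (κ : ℝ) (a b c : ℕ) : Prop :=
  IsABCTriple a b c ∧ κ * (c : ℝ) ≤ (a : ℝ) ∧ κ * (c : ℝ) ≤ (b : ℝ)

/-- TRANSFER C⁺ — the single-table (modulus-free) tame receptacle: ONE integer table in the crux's
windows whose sum over the primes of every `κ`-balanced triple is bounded by `c₃` in absolute value. -/
def IntegerTameReceptacle : Prop :=
  ∀ κ : ℝ, 0 < κ → ∀ ε : ℝ, 0 < ε → ∃ c₁ c₁' c₃ : ℝ, 0 < c₁ ∧ ∃ t : Table, InWindow ε c₁ c₁' t ∧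
    ∀ a b c : ℕ, IsBalanced κ a b c → |(recSum t a b c : ℝ)| ≤ c₃

/-- Easy half of the transfer (PROVED): a single exact table serves every modulus (`B := Φ_t`). -/
theorem tlr_of_itr (h : IntegerTameReceptacle) : TameLocalReceptacle := by
  intro κ hκ ε hε
  obtain ⟨c₁, c₁', c₃, hc₁, t, hw, hB⟩ := h κ hκ ε hε
  refine ⟨c₁, c₁', c₃, hc₁, 0, fun ℓ n _ _ _ => ⟨t, hw, fun a b c habc ha hb _ => ?_⟩⟩
  exact ⟨recSum t a b c, hB a b c ⟨habc, ha, hb⟩, Int.ModEq.refl _⟩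

/-- Index type of table entries. -/
abbrev Idx : Type := ℕ × ℕ × ℕ × ℕ × ℕ × ℕ × ℕ

/-- Uncurry a table at an index. -/
def atIdx (t : Table) (x : Idx) : ℤ := t x.1 x.2.1 x.2.2.1 x.2.2.2.1 x.2.2.2.2.1 x.2.2.2.2.2.1 x.2.2.2.2.2.2

/-- Hard half of the transfer (PROVED): compactness of the product of the finite windows
(`isCompact_univ_pi` + `IsCompact.tendsto_subseq`): from tables `t_ℓ` (ℓ prime → ∞, n = 1)
extract a pointwise limit; for a fixed triple all its data are eventually stable, `ℓ ∤ abc`, and the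
congruence at a modulus `ℓ > |Φ| + c₃` is an equality (`Int.eq_zero_of_abs_lt_dvd`). -/
theorem itr_of_tlr (h : TameLocalReceptacle) : IntegerTameReceptacle := by
  intro κ hκ ε hε
  obtain ⟨c₁, c₁', c₃, hc₁, m₀, H⟩ := h κ hκ ε hε
  -- a sequence of primes ℓ N ≥ max m₀ (max 5 N)
  choose ℓ hℓ using fun N : ℕ => Nat.exists_infinite_primes (max m₀ (max 5 N))
  have hℓN : ∀ N, N ≤ ℓ N := fun N => le_trans (le_max_right _ _ |>.trans (le_max_right _ _)) (hℓ N).1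
  -- tables for the moduli ℓ N (exponent 1)
  have hT : ∀ N : ℕ, ∃ t : Table, InWindow ε c₁ c₁' t ∧ ∀ a b c : ℕ, IsABCTriple a b c →
      κ * (c : ℝ) ≤ (a : ℝ) → κ * (c : ℝ) ≤ (b : ℝ) → ¬ ℓ N ∣ a * b * c →
      ∃ B : ℤ, |(B : ℝ)| ≤ c₃ ∧ recSum t a b c ≡ B [ZMOD ((ℓ N ^ 1 : ℕ) : ℤ)] := by
    intro N
    have h5 : 5 ≤ ℓ N := le_trans (le_max_left _ _ |>.trans (le_max_right _ _)) (hℓ N).1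
    have hm : m₀ ≤ ℓ N ^ 1 := by rw [pow_one]; exact le_trans (le_max_left _ _) (hℓ N).1
    obtain ⟨t, ht, hB⟩ := H (ℓ N) 1 (hℓ N).2 h5 hm
    exact ⟨t, ht, hB⟩
  choose t ht hB using hT
  -- uncurried, prime-truncated tables living in a compact box
  let T : ℕ → Idx → ℤ := fun N x => if x.1.Prime then atIdx (t N) x else 0
  let R : Idx → ℝ := fun x => c₁' * (((x.2.1 + x.2.2.1 + x.2.2.2.1 : ℕ) : ℝ) + 1) * Real.log x.1
  let K : Idx → Set ℤ := fun x => {m : ℤ | |(m : ℝ)| ≤ R x} ∪ {0}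
  have hKfin : ∀ x, (K x).Finite := by
    intro x
    refine Set.Finite.union ?_ (Set.finite_singleton 0)
    refine (Set.finite_Icc ⌊-R x⌋ ⌈R x⌉).subset ?_
    intro m hm
    simp only [Set.mem_setOf_eq] at hm
    obtain ⟨h1, h2⟩ := abs_le.mp hm
    refine ⟨?_, ?_⟩
    · have : ((⌊-R x⌋ : ℤ) : ℝ) ≤ (m : ℝ) := (Int.floor_le _).trans h1
      exact_mod_cast this
    · have : (m : ℝ) ≤ ((⌈R x⌉ : ℤ) : ℝ) := h2.trans (Int.le_ceil _)
      exact_mod_cast this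
  have hs : IsCompact (Set.pi Set.univ K) := isCompact_univ_pi fun x => (hKfin x).isCompact
  have hmem : ∀ N, T N ∈ Set.pi Set.univ K := by
    intro N
    refine Set.mem_univ_pi.2 fun x => ?_
    by_cases hp : x.1.Prime
    · left
      simp only [Set.mem_setOf_eq, T, if_pos hp, atIdx]
      exact (ht N x.1 x.2.1 x.2.2.1 x.2.2.2.1 x.2.2.2.2.1 x.2.2.2.2.2.1 x.2.2.2.2.2.2 hp).2
    · right
      simp [T, if_neg hp]
  obtain ⟨g, -, φ, hφ, hlim⟩ := hs.tendsto_subseq hmem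
  have hev : ∀ x : Idx, ∀ᶠ N in atTop, T (φ N) x = g x := by
    intro x
    have hx := tendsto_pi_nhds.1 hlim x
    simp only [nhds_discrete, tendsto_pure] at hx
    exact hx
  -- the limit table
  let tinf : Table := fun p i j k r s z => g (p, i, j, k, r, s, z)
  refine ⟨c₁, c₁', c₃, hc₁, tinf, ?_, ?_⟩
  · -- windows pass to the limit
    intro p i j k r s z hp
    obtain ⟨N, hN⟩ := (hev (p, i, j, k, r, s, z)).exists
    have hTN : T (φ N) (p, i, j, k, r, s, z) = t (φ N) p i j k r s z := by
      simp only [T, atIdx]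
      rw [if_pos hp]
    have hg : tinf p i j k r s z = t (φ N) p i j k r s z := by
      show g (p, i, j, k, r, s, z) = _
      rw [← hN, hTN]
    rw [hg]
    exact ht (φ N) p i j k r s z hp
  · -- exact boundedness on the balanced cell
    rintro a b c ⟨habc, ha, hb⟩
    set pf := (a * b * c).primeFactors with hpf
    let xi : ℕ → Idx := fun p => (p, a.factorization p, b.factorization p, c.factorization p,
      a / p ^ a.factorization p % p, b / p ^ b.factorization p % p, c / p ^ c.factorization p % p)
    let Z : ℝ := ∑ p ∈ pf, c₁' * (((a.factorization p + b.factorization p + c.factorization p : ℕ)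
      : ℝ) + 1) * Real.log p
    have h1 : ∀ᶠ N in atTop, ∀ p ∈ pf, T (φ N) (xi p) = g (xi p) :=
      (eventually_all_finset pf).2 fun p _ => hev (xi p)
    have h2 : ∀ᶠ N in atTop, a * b * c < N := eventually_gt_atTop _
    have h3 : ∀ᶠ N : ℕ in atTop, c₃ + Z < (N : ℝ) :=
      tendsto_natCast_atTop_atTop.eventually_gt_atTop _
    obtain ⟨N, hN1, hN2, hN3⟩ := (h1.and (h2.and h3)).exists
    have hφN : N ≤ φ N := hφ.id_le N
    have hLgt : a * b * c < ℓ (φ N) := lt_of_lt_of_le hN2 (hφN.trans (hℓN _))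
    have hLgtR : c₃ + Z < (ℓ (φ N) : ℝ) := by
      refine lt_of_lt_of_le hN3 ?_
      exact_mod_cast hφN.trans (hℓN _)
    obtain ⟨ha0, hb0, hsum, hcop⟩ := habc
    have habc0 : 0 < a * b * c := by
      have : 0 < c := by omega
      positivity
    have hndvd : ¬ ℓ (φ N) ∣ a * b * c := Nat.not_dvd_of_pos_of_lt habc0 hLgt
    obtain ⟨B, hBle, hmod⟩ := hB (φ N) a b c ⟨ha0, hb0, hsum, hcop⟩ ha hb hndvd
    -- the limit table agrees with t (φ N) on the data of this triple
    have hagree : recSum tinf a b c = recSum (t (φ N)) a b c := by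
      refine Finset.sum_congr rfl fun p hp => ?_
      have hpp : p.Prime := Nat.prime_of_mem_primeFactors hp
      have hTx : T (φ N) (xi p) = t (φ N) p (a.factorization p) (b.factorization p)
          (c.factorization p) (a / p ^ a.factorization p % p) (b / p ^ b.factorization p % p)
          (c / p ^ c.factorization p % p) := by
        simp only [T, atIdx, xi]
        rw [if_pos hpp]
      show g (xi p) = _
      rw [← hN1 p hp, hTx]
    -- a priori bound |recSum (t (φ N))| ≤ Z
    have hZ : |(recSum (t (φ N)) a b c : ℝ)| ≤ Z := by
      simp only [recSum, Int.cast_sum]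
      refine (abs_sum_le_sum_abs _ _).trans (Finset.sum_le_sum fun p hp => ?_)
      exact (ht (φ N) p _ _ _ _ _ _ (Nat.prime_of_mem_primeFactors hp)).2
    -- congruence to equality
    have hdvd : ((ℓ (φ N) : ℕ) : ℤ) ∣ B - recSum (t (φ N)) a b c := by
      have := hmod.dvd
      simpa [pow_one] using this
    have hlt : |B - recSum (t (φ N)) a b c| < ((ℓ (φ N) : ℕ) : ℤ) := by
      have hR : |((B - recSum (t (φ N)) a b c : ℤ) : ℝ)| < (ℓ (φ N) : ℝ) := by
        push_cast
        calc |(B : ℝ) - (recSum (t (φ N)) a b c : ℝ)|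
            ≤ |(B : ℝ)| + |(recSum (t (φ N)) a b c : ℝ)| := abs_sub _ _
          _ ≤ c₃ + Z := add_le_add hBle hZ
          _ < ℓ (φ N) := hLgtR
      exact_mod_cast hR
    have hzero : B - recSum (t (φ N)) a b c = 0 := Int.eq_zero_of_abs_lt_dvd hdvd hlt
    have hEq : recSum tinf a b c = B := by rw [hagree]; omega
    rw [hEq]
    exact hBle

/-- PINNING, averaging form (PROVED): two nonempty finite families on which `|Φ| ≤ c₃` have means
within `2c₃`. -/
theorem pinning_means {ι : Type} (F F' : Finset ι) (hF : F.Nonempty) (hF' : F'.Nonempty)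
    (Φ : ι → ℝ) (c₃ : ℝ) (h : ∀ x ∈ F, |Φ x| ≤ c₃) (h' : ∀ x ∈ F', |Φ x| ≤ c₃) :
    |(∑ x ∈ F, Φ x) / F.card - (∑ x ∈ F', Φ x) / F'.card| ≤ 2 * c₃ := by
  have hc : (0 : ℝ) < F.card := by exact_mod_cast hF.card_pos
  have hc' : (0 : ℝ) < F'.card := by exact_mod_cast hF'.card_pos
  have h1 : |(∑ x ∈ F, Φ x) / F.card| ≤ c₃ := by
    rw [abs_div, abs_of_pos hc, div_le_iff₀ hc]
    calc |∑ x ∈ F, Φ x| ≤ ∑ x ∈ F, |Φ x| := abs_sum_le_sum_abs _ _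
      _ ≤ ∑ _x ∈ F, c₃ := sum_le_sum h
      _ = c₃ * F.card := by rw [sum_const, nsmul_eq_mul, mul_comm]
  have h2 : |(∑ x ∈ F', Φ x) / F'.card| ≤ c₃ := by
    rw [abs_div, abs_of_pos hc', div_le_iff₀ hc']
    calc |∑ x ∈ F', Φ x| ≤ ∑ x ∈ F', |Φ x| := abs_sum_le_sum_abs _ _
      _ ≤ ∑ _x ∈ F', c₃ := sum_le_sum h'
      _ = c₃ * F'.card := by rw [sum_const, nsmul_eq_mul, mul_comm]
  calc |(∑ x ∈ F, Φ x) / F.card - (∑ x ∈ F', Φ x) / F'.card|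
      ≤ |(∑ x ∈ F, Φ x) / F.card| + |(∑ x ∈ F', Φ x) / F'.card| := abs_sub _ _
    _ ≤ c₃ + c₃ := add_le_add h1 h2
    _ = 2 * c₃ := by ring

/-- A real weight bounded by the (c₁' = 1) upper window. -/
def WindowBounded (w : RTable) : Prop :=
  ∀ q i j k r s z : ℕ, q.Prime → |w q i j k r s z| ≤ (((i + j + k : ℕ) : ℝ) + 1) * Real.log q

/-- A datum `D` OCCURS at `p` on the `κ`-balanced cell. -/
def Occurs (κ : ℝ) (p : ℕ) (D : ℕ × ℕ × ℕ × ℕ × ℕ × ℕ) : Prop :=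
  ∃ a b c : ℕ, IsBalanced κ a b c ∧ p ∈ (a * b * c).primeFactors ∧ datum a b c p = D

/-- The mean of `f` over a finite family of triples. -/
noncomputable def mean (F : Finset (ℕ × ℕ × ℕ)) (f : ℕ × ℕ × ℕ → ℝ) : ℝ :=
  (∑ T ∈ F, f T) / F.card

/-- EH — TERNARY-SMOOTH RESIDUE-PINNING HYPOTHESIS with absolute discrepancy `A` (the analytic input,
stated in exactly the form used).  For any prime `p` and two data at `p` with the same exponents
`(i,j,k)` that both occur on the `κ`-balanced cell, there are finite nonempty families `F, F'` of
`κ`-balanced triples carrying these data at `p` whose OTHER data have window-weighted intensity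
measures within `A`: every window-bounded weight has family means (away from `p`) within `A`.
Intended witnesses: `X^{1/3}`-smooth balanced triples `≤ X` conditioned at `p` (no informed prime),
counted by the circle method for friable `a + b = c` with two-prime congruence conditions
[Harper2016 Cor. 1 = `Literature.NumberTheory.DiophantineGeometry.XYZUpperHalf` doc; LagariasSoundararajan2011;
de la Bretèche 1999] at Bombieri–Vinogradov-level uniformity in the data prime `q ≤ X^{1/3}`. -/
def PinningFamilies (κ A : ℝ) : Prop :=
  ∀ (p i j k r s z r' s' z' : ℕ), p.Prime →
    Occurs κ p (i, j, k, r, s, z) → Occurs κ p (i, j, k, r', s', z') →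
    ∃ F F' : Finset (ℕ × ℕ × ℕ), F.Nonempty ∧ F'.Nonempty ∧
      (∀ T ∈ F, IsBalanced κ T.1 T.2.1 T.2.2 ∧ p ∈ (T.1 * T.2.1 * T.2.2).primeFactors ∧
        datum T.1 T.2.1 T.2.2 p = (i, j, k, r, s, z)) ∧
      (∀ T ∈ F', IsBalanced κ T.1 T.2.1 T.2.2 ∧ p ∈ (T.1 * T.2.1 * T.2.2).primeFactors ∧
        datum T.1 T.2.1 T.2.2 p = (i, j, k, r', s', z')) ∧
      ∀ w : RTable, WindowBounded w →
        |mean F (fun T => recSumAway w p T.1 T.2.1 T.2.2) -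
          mean F' (fun T => recSumAway w p T.1 T.2.1 T.2.2)| ≤ A

/-- Near-residue-freeness with slack `K`: two OCCURRING data at the same `(p; i,j,k)` get table
values within `K` of each other. -/
def NearResidueFree (κ K : ℝ) (t : Table) : Prop :=
  ∀ (p i j k r s z r' s' z' : ℕ), p.Prime →
    Occurs κ p (i, j, k, r, s, z) → Occurs κ p (i, j, k, r', s', z') →
    |(t p i j k r s z : ℝ) - (t p i j k r' s' z' : ℝ)| ≤ K

/-- Means are affine. -/
theorem mean_affine (F : Finset (ℕ × ℕ × ℕ)) (hF : F.Nonempty) (C m : ℝ) (g : ℕ × ℕ × ℕ → ℝ) :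
    mean F (fun T => C + m * g T) = C + m * mean F g := by
  have hc : (F.card : ℝ) ≠ 0 := by exact_mod_cast hF.card_pos.ne'
  simp only [mean]
  rw [Finset.sum_add_distrib, Finset.sum_const, nsmul_eq_mul, ← Finset.mul_sum]
  field_simp

/-- Splitting the receptacle sum at a prime `p` carrying a prescribed datum. -/
theorem recSum_split {c₁' : ℝ} (hc₁' : c₁' ≠ 0) (t : Table) {p a b c i j k r s z : ℕ}
    (hp : p ∈ (a * b * c).primeFactors) (hd : datum a b c p = (i, j, k, r, s, z)) :
    (recSum t a b c : ℝ) = (t p i j k r s z : ℝ) +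
      c₁' * recSumAway (fun q i j k r s z => (t q i j k r s z : ℝ) / c₁') p a b c := by
  simp only [datum, Prod.mk.injEq] at hd
  obtain ⟨h1, h2, h3, h4, h5, h6⟩ := hd
  unfold recSum recSumAway
  rw [← Finset.add_sum_erase _ _ hp]
  push_cast
  rw [h4, h5, h6, h1, h2, h3]
  congr 1
  rw [Finset.mul_sum]
  refine Finset.sum_congr rfl fun q _ => ?_
  simp only [evalAt, datum]
  field_simp

/-- PINNING ⇒ NEAR-RESIDUE-FREE (PROVED): split `Φ_t(T) = t(p; D_p) + c₁'·recSumAway (t/c₁') p T`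
on each family (`recSum_split`); the first term is constant on `F` (resp. `F'`), the second has means
within `c₁'A` by EH, and the total means are within `2c₃` (`pinning_means`). -/
theorem nearResidueFree_of_pinning {κ A ε c₁ c₁' c₃ : ℝ} (hc₁' : 0 < c₁') (t : Table)
    (hw : InWindow ε c₁ c₁' t) (hB : ∀ a b c : ℕ, IsBalanced κ a b c → |(recSum t a b c : ℝ)| ≤ c₃)
    (hE : PinningFamilies κ A) : NearResidueFree κ (2 * c₃ + c₁' * A) t := by
  intro p i j k r s z r' s' z' hp hocc hocc'
  obtain ⟨F, F', hFne, hF'ne, hF, hF', hW⟩ := hE p i j k r s z r' s' z' hp hocc hocc'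
  set w : RTable := fun q i j k r s z => (t q i j k r s z : ℝ) / c₁' with hw_def
  have hwb : WindowBounded w := by
    intro q i' j' k' r₀ s₀ z₀ hq
    simp only [hw_def]
    rw [abs_div, abs_of_pos hc₁', div_le_iff₀ hc₁']
    calc |(t q i' j' k' r₀ s₀ z₀ : ℝ)| ≤ c₁' * (((i' + j' + k' : ℕ) : ℝ) + 1) * Real.log q :=
        (hw q i' j' k' r₀ s₀ z₀ hq).2
      _ = (((i' + j' + k' : ℕ) : ℝ) + 1) * Real.log q * c₁' := by ring
  have hA := hW w hwb
  set Φ : ℕ × ℕ × ℕ → ℝ := fun T => (recSum t T.1 T.2.1 T.2.2 : ℝ) with hΦ_def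
  have hΦF : ∀ T ∈ F, |Φ T| ≤ c₃ := fun T hT => hB _ _ _ (hF T hT).1
  have hΦF' : ∀ T ∈ F', |Φ T| ≤ c₃ := fun T hT => hB _ _ _ (hF' T hT).1
  have hpin : |mean F Φ - mean F' Φ| ≤ 2 * c₃ := pinning_means F F' hFne hF'ne Φ c₃ hΦF hΦF'
  set g : ℕ × ℕ × ℕ → ℝ := fun T => recSumAway w p T.1 T.2.1 T.2.2 with hg_def
  have hmF : mean F Φ = (t p i j k r s z : ℝ) + c₁' * mean F g := by
    rw [← mean_affine F hFne]
    unfold mean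
    congr 1
    refine Finset.sum_congr rfl fun T hT => ?_
    exact recSum_split hc₁'.ne' t (hF T hT).2.1 (hF T hT).2.2
  have hmF' : mean F' Φ = (t p i j k r' s' z' : ℝ) + c₁' * mean F' g := by
    rw [← mean_affine F' hF'ne]
    unfold mean
    congr 1
    refine Finset.sum_congr rfl fun T hT => ?_
    exact recSum_split hc₁'.ne' t (hF' T hT).2.1 (hF' T hT).2.2
  rw [hmF, hmF'] at hpin
  have e : (t p i j k r s z : ℝ) - (t p i j k r' s' z' : ℝ) =
      ((t p i j k r s z : ℝ) + c₁' * mean F g - ((t p i j k r' s' z' : ℝ) + c₁' * mean F' g)) -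
        c₁' * (mean F g - mean F' g) := by ring
  rw [e]
  calc |((t p i j k r s z : ℝ) + c₁' * mean F g - ((t p i j k r' s' z' : ℝ) + c₁' * mean F' g)) -
        c₁' * (mean F g - mean F' g)|
      ≤ |(t p i j k r s z : ℝ) + c₁' * mean F g - ((t p i j k r' s' z' : ℝ) + c₁' * mean F' g)| +
        |c₁' * (mean F g - mean F' g)| := abs_sub _ _
    _ ≤ 2 * c₃ + c₁' * A := by
        refine add_le_add hpin ?_
        rw [abs_mul, abs_of_pos hc₁']
        exact mul_le_mul_of_nonneg_left hA hc₁'.le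

/-- FOUR-FAMILY SLOPE CONTRADICTION (STUB, size L; refuter ATTACK-stmt-ABC-14354 §4.1 re-run with the
`O(K·ω(abc))` residue slack): for `κ ≤ 1/5` average `Φ_t` over `(u, u+1, 2u+1)`, `(2^N, b, 2^N+b)`,
`(a, 2^N, a+2^N)`, `(a, 2^{N+2}−a, 2^{N+2})` at scale `X = 2^N`; Chebyshev/Mertens mean values cancel
and leave `t̄(2;N,0,0) + t̄(2;0,N,0) + t̄(2;0,0,N+2) = O(c₁' + (c₃ + K)·log log X)` against the lower
window `≥ 3c₁(2N − 7 − ε) log 2 ≍ c₁ log X`. -/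
theorem false_of_nearResidueFree {κ ε c₁ c₁' c₃ K : ℝ} (hκ : 0 < κ) (hκ' : κ ≤ 1 / 5)
    (hε : 0 < ε) (hc₁ : 0 < c₁) (t : Table) (hw : InWindow ε c₁ c₁' t)
    (hB : ∀ a b c : ℕ, IsBalanced κ a b c → |(recSum t a b c : ℝ)| ≤ c₃)
    (hN : NearResidueFree κ K t) : False := by
  sorry

/-- Window consistency forces `c₁' > 0` once `c₁ > 0` (evaluate the window at `p = 2`, `i+j+k = 4`). -/
theorem c₁'_pos_of_inWindow {ε c₁ c₁' : ℝ} (hε : ε ≤ 1) (hc₁ : 0 < c₁) {t : Table}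
    (hw : InWindow ε c₁ c₁' t) : 0 < c₁' := by
  have h := hw 2 4 0 0 0 0 0 Nat.prime_two
  have hlog : 0 < Real.log (2 : ℕ) := by
    rw [Nat.cast_ofNat]; exact Real.log_pos (by norm_num)
  obtain ⟨hlo, hhi⟩ := h
  have habs : (t 2 4 0 0 0 0 0 : ℝ) ≤ |(t 2 4 0 0 0 0 0 : ℝ)| := le_abs_self _
  have h5 : (((4 + 0 + 0 : ℕ) : ℝ) + 1) = 5 := by norm_num
  have h2 : (2 * ((4 + 0 + 0 : ℕ) : ℝ) - 6 - ε) ≥ 1 := by push_cast; linarith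
  rw [h5] at hhi
  have hpos : 0 < c₁ * (2 * ((4 + 0 + 0 : ℕ) : ℝ) - 6 - ε) * Real.log (2 : ℕ) := by positivity
  nlinarith

/-- COMPOSITION (modulo the stubs): the ternary-smooth pinning hypothesis refutes the crux. -/
theorem not_tameLocalReceptacle_of_pinning (A : ℝ)
    (hE : ∀ κ : ℝ, 0 < κ → PinningFamilies κ A) : ¬ TameLocalReceptacle := by
  intro h
  obtain ⟨c₁, c₁', c₃, hc₁, t, hw, hB⟩ := itr_of_tlr h (1 / 5) (by norm_num) 1 one_pos
  have hc₁' : 0 < c₁' := c₁'_pos_of_inWindow le_rfl hc₁ hw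
  exact false_of_nearResidueFree (by norm_num : (0 : ℝ) < 1 / 5) le_rfl one_pos hc₁ t hw hB
    (nearResidueFree_of_pinning hc₁' t hw hB (hE (1 / 5) (by norm_num)))

end Summit.ABC.ABC.Cruxes.TameLocalReceptacle.TernarySmoothPinning
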